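import Literature.NumberTheory.LFunctions.MoebiusWalshTypeIIZeroEval
import HarnessLib

/-!
# The type-II hypothesis of the assembly, bottom window `K = 0` — proved

Topic `Literature/NumberTheory/LFunctions`, a proofs companion of `MoebiusWalshCircuits.lean`
(named facts `bourgain_moebius_walsh_uniform`, `bourgain_liouville_walsh_uniform`: J. Bourgain,
*Möbius–Walsh correlation bounds and an estimate of Mauduit and Rivat*, J. Anal. Math. **119**
(2013) 147–163 = arXiv:1109.2784 [Bourgain2013MoebiusWalsh], Theorem 1). Everything here is PROVED
(theorems only; no definition, no named fact).

`MoebiusWalshAssembly.lean` (`bourgain_moebius_walsh_uniform_of_typeII`) and its Liouville twin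
reduce Theorem 1 to ONE per-box statement, the type-II estimate (2.29) of the paper in the shape

  `|boxSum T i j α β| ≤ 2^{i+j} (i+j+2)^C (2^{-c g₀} + 2^{Cρ - c i} + 2^{Cρ - c |T ∩ [K, K+i+ρ+g₀+1)|})`

for admissible window origins `K`. This file proves that shape for the BOTTOM window `K = 0`
(`typeII_hyp_zero`), with the explicit constants `C = 10` and
`c = min(1/2, θ c₂, c₀/2)` (`c₂ = walshSupExponent`, `c₀ = typeIIGap = 1 - 2κ`,
`θ = typeIITheta = c₀/(1+c₀)`), from the tree's evaluated `K = 0` type-II estimate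
`MoebiusWalshTypeII.boxSum_sq_typeII_zero_eval` (Bourgain §2, (2.1)–(2.22), proved in
`MoebiusWalshTypeIIZero*.lean`):
`(boxSum)² ≤ 4·4^{i+j} (2^{-ρ} + 6·2^{-t} + 12·2^{ρ-j} + zeroLoss i ρ t η)`, `η = 2·2^{-c₂|T ∩ [0, i+ρ+1+t)|}`,
read with the guard `t = g₀ ≤ ρ` (the two window conventions coincide: `[0, i + ρ + 1 + t)`).
The bookkeeping is: square the target, drop the cross terms, and dominate the four pieces —
`2^{-ρ}, 6·2^{-t} ≤ (L^{2C}/16) 2^{-2c g₀}`; `12·2^{ρ-j} ≤ (L^{2C}/16) 2^{2(Cρ - ci)}`;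
`zeroLoss ≤ 100 (q+1)² 8^ρ 4^t (η² + η^{2θ} + 2^{-c₀ i}) ≤ (L^{2C}/16)(2^{2(Cρ-ci)} + 2^{2(Cρ - c d)})`
using `η ≤ 2`, `η², η^{2θ} ≤ 4·2^{-2θc₂ d}`, `(q+1)² ≤ L² 16^ρ` (`L = i+j+2`, `q = i+ρ+1+t`).
The shifted windows `K > 0` (Bourgain (2.23)–(2.27)) are the remaining half of the hypothesis.

## References

* J. Bourgain, J. Anal. Math. 119 (2013) 147–163; arXiv:1109.2784, §2 (2.22), (2.29).
  [Bourgain2013MoebiusWalsh]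
-/

noncomputable section

open Finset Real

namespace Literature.NumberTheory.LFunctions.MoebiusWalsh

open Literature.NumberTheory.LFunctions.MoebiusWalshVaughan (boxSum)
open Literature.NumberTheory.LFunctions.MoebiusWalshTypeII (typeIIGap typeIITheta zeroLoss
  typeIIGap_pos typeIIGap_lt_one typeIITheta_pos typeIITheta_lt_one boxSum_sq_typeII_zero_eval)

/-- `2^{2x} = (2^x)²`. [folklore] -/
theorem two_rpow_two_mul (x : ℝ) : (2 : ℝ) ^ (2 * x) = ((2 : ℝ) ^ x) ^ 2 := by
  rw [mul_comm, Real.rpow_mul (by norm_num), Real.rpow_two]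

set_option maxHeartbeats 800000 in
-- one long chain of explicit real inequalities
/-- **The type-II hypothesis of the assembly for the bottom window `K = 0`.** With
`c = min(1/2, θc₂, c₀/2)` and `C = 10`: for `i ≤ j`, `1 ≤ g₀ ≤ ρ ≤ j`, `|α|, |β| ≤ 1` and any `T`,
`|boxSum T i j α β| ≤ 2^{i+j}(i+j+2)^{10}(2^{-c g₀} + 2^{10ρ - ci} + 2^{10ρ - c|T ∩ [0, i+ρ+g₀+1)|})`.
[cite: Bourgain2013MoebiusWalsh, §2 (2.22), (2.29)] -/
theorem typeII_hyp_zero (i j ρ g₀ : ℕ) (T : Finset ℕ) (α β : ℕ → ℝ) (hij : i ≤ j)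
    (hg₀ : 1 ≤ g₀) (hg₀ρ : g₀ ≤ ρ) (hρj : ρ ≤ j) (hα : ∀ a, |α a| ≤ 1) (hβ : ∀ b, |β b| ≤ 1) :
    |boxSum T i j α β| ≤ 2 ^ (i + j) * ((i : ℝ) + j + 2) ^ (10 : ℝ) *
      ((2 : ℝ) ^ (-(min (1 / 2) (min (typeIITheta * walshSupExponent) (typeIIGap / 2)) * g₀)) +
        (2 : ℝ) ^ (10 * ρ - min (1 / 2) (min (typeIITheta * walshSupExponent) (typeIIGap / 2)) * i) +
        (2 : ℝ) ^ (10 * ρ - min (1 / 2) (min (typeIITheta * walshSupExponent) (typeIIGap / 2)) *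
          ((T.filter (fun t => 0 ≤ t ∧ t < 0 + i + (ρ + g₀ + 1))).card : ℝ))) := by
  have h2 : (0 : ℝ) < 2 := by norm_num
  have hc₂0 : 0 < walshSupExponent := walshSupExponent_pos
  have hc₀0 : 0 < typeIIGap := typeIIGap_pos
  have hθ0 : 0 < typeIITheta := typeIITheta_pos
  have hθ1 : typeIITheta < 1 := typeIITheta_lt_one
  -- the exponent `c`, as an opaque variable
  have hcpos' : 0 < min (1 / 2) (min (typeIITheta * walshSupExponent) (typeIIGap / 2)) := by positivity
  have hc_half' : min (1 / 2) (min (typeIITheta * walshSupExponent) (typeIIGap / 2)) ≤ 1 / 2 := min_le_left _ _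
  have hc_θ' : min (1 / 2) (min (typeIITheta * walshSupExponent) (typeIIGap / 2)) ≤ typeIITheta * walshSupExponent :=
    (min_le_right _ _).trans (min_le_left _ _)
  have hc_gap' : min (1 / 2) (min (typeIITheta * walshSupExponent) (typeIIGap / 2)) ≤ typeIIGap / 2 :=
    (min_le_right _ _).trans (min_le_right _ _)
  generalize hcgen : min (1 / 2) (min (typeIITheta * walshSupExponent) (typeIIGap / 2)) = c at hcpos' hc_half' hc_θ' hc_gap' ⊢
  -- the polynomial loss `L = i + j + 2`
  have hL2' : (2 : ℝ) ≤ (i : ℝ) + j + 2 := by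
    have : (0 : ℝ) ≤ (i : ℝ) + j := by positivity
    linarith
  have hLC' : ((i : ℝ) + j + 2) ^ (10 : ℝ) = ((i : ℝ) + j + 2) ^ (10 : ℕ) := by
    rw [← Real.rpow_natCast]; norm_num
  rw [hLC']
  generalize hLgen : ((i : ℝ) + j + 2) = L at hL2' ⊢
  have hL0 : 0 ≤ L := by linarith
  have hL1 : 1 ≤ L := by linarith
  -- the window, the digit count `d` and the sup datum `η`, as plain variables
  have hwin : (T.filter (fun x => x < i + ρ + 1 + g₀)).card =
      (T.filter (fun t => 0 ≤ t ∧ t < 0 + i + (ρ + g₀ + 1))).card := by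
    congr 1
    refine Finset.filter_congr fun t _ => ?_
    constructor
    · intro h; exact ⟨Nat.zero_le _, by omega⟩
    · intro h; omega
  have hin := boxSum_sq_typeII_zero_eval T g₀ hij hρj α β hα hβ
  rw [hwin] at hin
  have hd0 : (0 : ℝ) ≤ ((T.filter (fun t => 0 ≤ t ∧ t < 0 + i + (ρ + g₀ + 1))).card : ℝ) := Nat.cast_nonneg _
  generalize hdgen : ((T.filter (fun t => 0 ≤ t ∧ t < 0 + i + (ρ + g₀ + 1))).card : ℝ) = d at hin hd0 ⊢
  have hη0 : 0 < 2 * (2 : ℝ) ^ (-(walshSupExponent * d)) := by positivity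
  have hη2 : 2 * (2 : ℝ) ^ (-(walshSupExponent * d)) ≤ 2 := by
    have : (2 : ℝ) ^ (-(walshSupExponent * d)) ≤ 1 := Real.rpow_le_one_of_one_le_of_nonpos one_le_two (by
      have : 0 ≤ walshSupExponent * d := by positivity
      linarith)
    linarith
  have hηdef : (2 * (2 : ℝ) ^ (-(walshSupExponent * d))) ^ (2 * typeIITheta) =
      (2 : ℝ) ^ (2 * typeIITheta) * (2 : ℝ) ^ (-(2 * (typeIITheta * walshSupExponent) * d)) := by
    rw [Real.mul_rpow h2.le (Real.rpow_nonneg h2.le _), ← Real.rpow_mul h2.le]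
    congr 1; ring_nf
  have hηsq : (2 * (2 : ℝ) ^ (-(walshSupExponent * d))) ^ 2 = 4 * (2 : ℝ) ^ (-(2 * walshSupExponent * d)) := by
    rw [mul_pow, ← Real.rpow_natCast ((2 : ℝ) ^ (-(walshSupExponent * d))) 2, ← Real.rpow_mul h2.le]
    norm_num; ring_nf
  generalize hηgen : 2 * (2 : ℝ) ^ (-(walshSupExponent * d)) = η at hin hη0 hη2 hηdef hηsq
  -- the three targets, as opaque variables
  have hA0 : 0 < (2 : ℝ) ^ (-(c * g₀)) := Real.rpow_pos_of_pos h2 _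
  have hB0 : 0 < (2 : ℝ) ^ (10 * ρ - c * i) := Real.rpow_pos_of_pos h2 _
  have hD0 : 0 < (2 : ℝ) ^ (10 * ρ - c * d) := Real.rpow_pos_of_pos h2 _
  have hρ1 : 1 ≤ ρ := hg₀.trans hg₀ρ
  have hρ1r : (1 : ℝ) ≤ ρ := by exact_mod_cast hρ1
  -- `2^{-g₀} ≤ A²`
  have hpow_g : (2 : ℝ) ^ (-(g₀ : ℝ)) ≤ ((2 : ℝ) ^ (-(c * g₀))) ^ 2 := by
    rw [← two_rpow_two_mul]
    refine Real.rpow_le_rpow_of_exponent_le one_le_two ?_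
    have hg0 : (0 : ℝ) ≤ g₀ := Nat.cast_nonneg _
    have h1 : 2 * c * (g₀ : ℝ) ≤ 1 * g₀ := mul_le_mul_of_nonneg_right (by linarith only [hc_half']) hg0
    linarith only [h1]
  -- `2^{ρ - j} ≤ B²`
  have hpow_b : (2 : ℝ) ^ ρ / 2 ^ j ≤ ((2 : ℝ) ^ (10 * ρ - c * i)) ^ 2 := by
    rw [← two_rpow_two_mul]
    have e : (2 : ℝ) ^ ρ / 2 ^ j = (2 : ℝ) ^ ((ρ : ℝ) - j) := by
      rw [Real.rpow_sub h2, Real.rpow_natCast, Real.rpow_natCast]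
    rw [e]
    refine Real.rpow_le_rpow_of_exponent_le one_le_two ?_
    have hij' : (i : ℝ) ≤ j := by exact_mod_cast hij
    have hρ0 : (0 : ℝ) ≤ ρ := Nat.cast_nonneg _
    have hi0 : (0 : ℝ) ≤ i := Nat.cast_nonneg _
    have h1 : 2 * c * (i : ℝ) ≤ 1 * i := mul_le_mul_of_nonneg_right (by linarith only [hc_half']) hi0
    linarith only [hij', hρ0, h1]
  -- `2^{11} 2^{9ρ} 2^{-2cd} ≤ D²`, `2^{11} 2^{9ρ} 2^{-2ci} ≤ B²`
  have h211 : (2 : ℝ) ^ (11 : ℕ) = (2 : ℝ) ^ (11 : ℝ) := by rw [← Real.rpow_natCast]; norm_num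
  have hDsq : (2 : ℝ) ^ (11 : ℕ) * ((2 : ℝ) ^ (9 * (ρ : ℝ)) * (2 : ℝ) ^ (-(2 * c * d))) ≤
      ((2 : ℝ) ^ (10 * ρ - c * d)) ^ 2 := by
    rw [← two_rpow_two_mul, ← Real.rpow_add h2, h211, ← Real.rpow_add h2]
    refine Real.rpow_le_rpow_of_exponent_le one_le_two ?_
    linarith only [hρ1r]
  have hBsq : (2 : ℝ) ^ (11 : ℕ) * ((2 : ℝ) ^ (9 * (ρ : ℝ)) * (2 : ℝ) ^ (-(2 * c * i))) ≤
      ((2 : ℝ) ^ (10 * ρ - c * i)) ^ 2 := by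
    rw [← two_rpow_two_mul, ← Real.rpow_add h2, h211, ← Real.rpow_add h2]
    refine Real.rpow_le_rpow_of_exponent_le one_le_two ?_
    linarith only [hρ1r]
  -- the analytic savings against `B², D²`
  have hgap : ((2 : ℝ) ^ i) ^ (-typeIIGap) ≤ (2 : ℝ) ^ (-(2 * c * i)) := by
    rw [← Real.rpow_natCast, ← Real.rpow_mul h2.le]
    refine Real.rpow_le_rpow_of_exponent_le one_le_two ?_
    have hi0 : (0 : ℝ) ≤ i := Nat.cast_nonneg _
    have h7 : 2 * c * (i : ℝ) ≤ typeIIGap * i := mul_le_mul_of_nonneg_right (by linarith only [hc_gap']) hi0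
    have e : ((i : ℕ) : ℝ) * -typeIIGap = -(typeIIGap * i) := by ring
    linarith only [h7, e]
  have hθc : (2 : ℝ) ^ (-(2 * (typeIITheta * walshSupExponent) * d)) ≤ (2 : ℝ) ^ (-(2 * c * d)) := by
    refine Real.rpow_le_rpow_of_exponent_le one_le_two ?_
    have h7 : c * d ≤ typeIITheta * walshSupExponent * d := mul_le_mul_of_nonneg_right hc_θ' hd0
    linarith only [h7]
  generalize hAgen : (2 : ℝ) ^ (-(c * g₀)) = A at hA0 hpow_g ⊢
  generalize hBgen : (2 : ℝ) ^ (10 * ρ - c * i) = B at hB0 hpow_b hBsq ⊢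
  generalize hDgen : (2 : ℝ) ^ (10 * ρ - c * d) = D at hD0 hDsq ⊢
  generalize hUgen : (2 : ℝ) ^ (-(2 * c * d)) = U at hDsq hθc
  generalize hVgen : (2 : ℝ) ^ (-(2 * c * i)) = V at hBsq hgap
  generalize hPgen : (2 : ℝ) ^ (9 * (ρ : ℝ)) = P9 at hDsq hBsq
  -- powers of `L`
  have hL18 : (2 : ℝ) ^ (18 : ℕ) ≤ L ^ (18 : ℕ) := pow_le_pow_left₀ h2.le hL2' 18
  have hL20' : (2 : ℝ) ^ (20 : ℕ) ≤ L ^ (20 : ℕ) := pow_le_pow_left₀ h2.le hL2' 20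
  have hLsq : (4 : ℝ) ≤ L ^ (2 : ℕ) := by
    have h1 := mul_le_mul hL2' hL2' (by norm_num) hL0
    have e : L ^ (2 : ℕ) = L * L := by ring
    linarith only [h1, e]
  have hL20 : 48 + 4 * L ^ (2 : ℕ) ≤ L ^ (20 : ℕ) := by
    have h1 : L ^ (2 : ℕ) * (2 : ℝ) ^ (18 : ℕ) ≤ L ^ (2 : ℕ) * L ^ (18 : ℕ) :=
      mul_le_mul_of_nonneg_left hL18 (by positivity)
    have h2' : L ^ (2 : ℕ) * L ^ (18 : ℕ) = L ^ (20 : ℕ) := by ring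
    norm_num at h1
    linarith only [h1, h2', hLsq]
  ------------------------------------------------------------------
  -- piece 1 and 2: `1/2^ρ + 6/2^t ≤ 7 A²`
  have hg₀pow : (2 : ℝ) ^ (-(g₀ : ℝ)) = 1 / 2 ^ g₀ := by
    rw [Real.rpow_neg h2.le, Real.rpow_natCast, one_div]
  have hp1 : 1 / (2 : ℝ) ^ ρ ≤ A ^ 2 := by
    refine le_trans ?_ hpow_g
    rw [hg₀pow]
    exact div_le_div_of_nonneg_left zero_le_one (by positivity) (pow_le_pow_right₀ one_le_two hg₀ρ)
  have hp2 : 6 / (2 : ℝ) ^ g₀ ≤ 6 * A ^ 2 := by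
    rw [hg₀pow] at hpow_g
    calc 6 / (2 : ℝ) ^ g₀ = 6 * (1 / 2 ^ g₀) := by ring
      _ ≤ 6 * A ^ 2 := by gcongr
  -- piece 3
  have hp3 : 12 * (2 : ℝ) ^ ρ / 2 ^ j ≤ 12 * B ^ 2 := by
    calc 12 * (2 : ℝ) ^ ρ / 2 ^ j = 12 * (2 ^ ρ / 2 ^ j) := by ring
      _ ≤ 12 * B ^ 2 := by gcongr
  ------------------------------------------------------------------
  -- piece 4: `zeroLoss ≤ L² (B² + D²)`
  have hηθ : η ^ 2 + η ^ (2 * typeIITheta) ≤ 20 * (2 : ℝ) ^ (-(2 * (typeIITheta * walshSupExponent) * d)) := by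
    have h22 : (2 : ℝ) ^ (2 * typeIITheta) ≤ 4 := by
      calc (2 : ℝ) ^ (2 * typeIITheta) ≤ (2 : ℝ) ^ (2 : ℝ) :=
            Real.rpow_le_rpow_of_exponent_le one_le_two (by linarith only [hθ1])
        _ = 4 := by norm_num
    have hpos : 0 ≤ (2 : ℝ) ^ (-(2 * (typeIITheta * walshSupExponent) * d)) := Real.rpow_nonneg h2.le _
    have hηθle : η ^ (2 * typeIITheta) ≤ 4 * (2 : ℝ) ^ (-(2 * (typeIITheta * walshSupExponent) * d)) := by
      rw [hηdef]; exact mul_le_mul_of_nonneg_right h22 hpos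
    have hη2le : η ^ 2 ≤ 4 * (2 : ℝ) ^ (-(2 * (typeIITheta * walshSupExponent) * d)) := by
      rw [hηsq]
      refine mul_le_mul_of_nonneg_left (Real.rpow_le_rpow_of_exponent_le one_le_two ?_) (by norm_num)
      have h7 : typeIITheta * walshSupExponent * d ≤ 1 * walshSupExponent * d := by
        have := mul_le_mul_of_nonneg_right hθ1.le (show 0 ≤ walshSupExponent * d by positivity)
        linarith only [this]
      linarith only [h7]
    linarith only [hηθle, hη2le, hpos]
  have hanal : η ^ 2 + η ^ (2 * typeIITheta) + ((2 : ℝ) ^ i) ^ (-typeIIGap) ≤ 20 * U + V := by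
    linarith only [hηθ, hgap, hθc]
  have hZ : zeroLoss i ρ g₀ η ≤ L ^ (2 : ℕ) * (B ^ 2 + D ^ 2) := by
    unfold zeroLoss
    -- the polynomial factor: `q (q+1) ≤ (q+1)² ≤ L² 16^ρ`, `q = i+ρ+1+g₀`
    have hq1 : (((i + ρ + 1 + g₀ : ℕ) : ℝ)) * (((i + ρ + 1 + g₀ : ℕ) : ℝ) + 1) ≤
        ((((i + ρ + 1 + g₀ : ℕ) : ℝ)) + 1) ^ 2 := by
      have h0 : (0 : ℝ) ≤ ((i + ρ + 1 + g₀ : ℕ) : ℝ) := Nat.cast_nonneg _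
      have e : ((((i + ρ + 1 + g₀ : ℕ) : ℝ)) + 1) ^ 2 =
          (((i + ρ + 1 + g₀ : ℕ) : ℝ)) * (((i + ρ + 1 + g₀ : ℕ) : ℝ) + 1) + (((i + ρ + 1 + g₀ : ℕ) : ℝ) + 1) := by ring
      linarith only [h0, e]
    have h4 : (1 : ℝ) ≤ (4 : ℝ) ^ ρ := one_le_pow₀ (by norm_num)
    have hq2 : (((i + ρ + 1 + g₀ : ℕ) : ℝ)) + 1 ≤ L * (4 : ℝ) ^ ρ := by
      have hρ4 : (2 : ℝ) * ρ + 2 ≤ 2 * (4 : ℝ) ^ ρ := by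
        have h14 : (ρ : ℝ) + 1 ≤ (2 : ℝ) ^ ρ := by
          have := Nat.lt_two_pow_self (n := ρ)
          exact_mod_cast this
        have h24 : (2 : ℝ) ^ ρ ≤ (4 : ℝ) ^ ρ := pow_le_pow_left₀ (by norm_num) (by norm_num) ρ
        linarith only [h14, h24]
      have hqL : (((i + ρ + 1 + g₀ : ℕ) : ℝ)) + 1 ≤ L + 2 * ρ := by
        rw [← hLgen]; push_cast
        have : (g₀ : ℝ) ≤ ρ := by exact_mod_cast hg₀ρ
        linarith only [this]
      have h5 : 2 * ((4 : ℝ) ^ ρ - 1) ≤ L * ((4 : ℝ) ^ ρ - 1) :=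
        mul_le_mul_of_nonneg_right hL2' (by linarith only [h4])
      linarith only [hqL, hρ4, h5]
    have hpoly : 100 * (((i + ρ + 1 + g₀ : ℕ) : ℝ)) * (((i + ρ + 1 + g₀ : ℕ) : ℝ) + 1) * ((2 : ℝ) ^ ρ) ^ 3 * 4 ^ g₀ ≤
        100 * (L ^ 2 * (16 : ℝ) ^ ρ) * (8 : ℝ) ^ ρ * (4 : ℝ) ^ ρ := by
      have h1 : (((i + ρ + 1 + g₀ : ℕ) : ℝ)) * (((i + ρ + 1 + g₀ : ℕ) : ℝ) + 1) ≤ L ^ 2 * (16 : ℝ) ^ ρ := by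
        calc (((i + ρ + 1 + g₀ : ℕ) : ℝ)) * (((i + ρ + 1 + g₀ : ℕ) : ℝ) + 1)
            ≤ ((((i + ρ + 1 + g₀ : ℕ) : ℝ)) + 1) ^ 2 := hq1
          _ ≤ (L * (4 : ℝ) ^ ρ) ^ 2 := by gcongr
          _ = L ^ 2 * (16 : ℝ) ^ ρ := by
              rw [mul_pow, ← pow_mul, show (16 : ℝ) = 4 ^ 2 by norm_num, ← pow_mul]; ring_nf
      have h3 : ((2 : ℝ) ^ ρ) ^ 3 = (8 : ℝ) ^ ρ := by
        rw [← pow_mul, show (8 : ℝ) = 2 ^ 3 by norm_num, ← pow_mul]; ring_nf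
      have h4' : (4 : ℝ) ^ g₀ ≤ (4 : ℝ) ^ ρ := pow_le_pow_right₀ (by norm_num) hg₀ρ
      rw [h3]
      have h5 := mul_le_mul h1 h4' (by positivity) (by positivity)
      have h6 := mul_le_mul_of_nonneg_left h5 (show (0 : ℝ) ≤ 100 * (8 : ℝ) ^ ρ by positivity)
      have e1 : 100 * (((i + ρ + 1 + g₀ : ℕ) : ℝ)) * (((i + ρ + 1 + g₀ : ℕ) : ℝ) + 1) * (8 : ℝ) ^ ρ * 4 ^ g₀ =
          100 * (8 : ℝ) ^ ρ * ((((i + ρ + 1 + g₀ : ℕ) : ℝ)) * (((i + ρ + 1 + g₀ : ℕ) : ℝ) + 1) * 4 ^ g₀) := by ring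
      have e2 : 100 * (L ^ 2 * (16 : ℝ) ^ ρ) * (8 : ℝ) ^ ρ * (4 : ℝ) ^ ρ =
          100 * (8 : ℝ) ^ ρ * (L ^ 2 * (16 : ℝ) ^ ρ * (4 : ℝ) ^ ρ) := by ring
      rw [e1, e2]; exact h6
    have h512 : (16 : ℝ) ^ ρ * (8 : ℝ) ^ ρ * (4 : ℝ) ^ ρ = P9 := by
      rw [← hPgen, ← mul_pow, ← mul_pow, ← Real.rpow_natCast, show (16 * 8 * 4 : ℝ) = 2 ^ (9 : ℝ) by norm_num,
        ← Real.rpow_mul h2.le]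
    have hLB : 0 ≤ L ^ (2 : ℕ) * B ^ 2 := by positivity
    have hLD : 0 ≤ L ^ (2 : ℕ) * D ^ 2 := by positivity
    calc 100 * (((i + ρ + 1 + g₀ : ℕ) : ℝ)) * (((i + ρ + 1 + g₀ : ℕ) : ℝ) + 1) * ((2 : ℝ) ^ ρ) ^ 3 * 4 ^ g₀ *
          (η ^ 2 + η ^ (2 * typeIITheta) + ((2 : ℝ) ^ i) ^ (-typeIIGap))
        ≤ (100 * (L ^ 2 * (16 : ℝ) ^ ρ) * (8 : ℝ) ^ ρ * (4 : ℝ) ^ ρ) * (20 * U + V) :=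
          mul_le_mul hpoly hanal (by positivity) (by positivity)
      _ = 100 * L ^ 2 * (20 * (P9 * U) + P9 * V) := by rw [← h512]; ring
      _ ≤ 100 * L ^ 2 * ((20 * D ^ 2 + B ^ 2) / (2 : ℝ) ^ (11 : ℕ)) := by
          gcongr
          rw [le_div_iff₀ (by positivity)]
          have e : (20 * (P9 * U) + P9 * V) * 2 ^ 11 =
              20 * ((2 : ℝ) ^ (11 : ℕ) * (P9 * U)) + (2 : ℝ) ^ (11 : ℕ) * (P9 * V) := by ring
          rw [e]
          linarith only [hDsq, hBsq]
      _ ≤ L ^ (2 : ℕ) * (B ^ 2 + D ^ 2) := by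
          have e : 100 * L ^ 2 * ((20 * D ^ 2 + B ^ 2) / (2 : ℝ) ^ (11 : ℕ)) =
              (2000 / 2048) * (L ^ (2 : ℕ) * D ^ 2) + (100 / 2048) * (L ^ (2 : ℕ) * B ^ 2) := by norm_num; ring
          rw [e]
          linarith only [hLB, hLD]
  ------------------------------------------------------------------
  -- assemble: `S ≤ (L^{20}/4)(A² + B² + D²) ≤ (L^{10}(A+B+D)/2)²`
  have hSle : 1 / (2 : ℝ) ^ ρ + 6 / 2 ^ g₀ + 12 * 2 ^ ρ / 2 ^ j + zeroLoss i ρ g₀ η ≤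
      (L ^ (10 : ℕ) * (A + B + D) / 2) ^ 2 := by
    have h1 : 1 / (2 : ℝ) ^ ρ + 6 / 2 ^ g₀ + 12 * 2 ^ ρ / 2 ^ j + zeroLoss i ρ g₀ η ≤
        7 * A ^ 2 + 12 * B ^ 2 + L ^ (2 : ℕ) * (B ^ 2 + D ^ 2) := by
      linarith only [hp1, hp2, hp3, hZ]
    have h2' : 7 * A ^ 2 + 12 * B ^ 2 + L ^ (2 : ℕ) * (B ^ 2 + D ^ 2) ≤
        (L ^ (20 : ℕ) / 4) * (A ^ 2 + B ^ 2 + D ^ 2) := by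
      have f1 : (2 : ℝ) ^ (20 : ℕ) * A ^ 2 ≤ L ^ (20 : ℕ) * A ^ 2 := mul_le_mul_of_nonneg_right hL20' (sq_nonneg A)
      have f2 : (48 + 4 * L ^ (2 : ℕ)) * B ^ 2 ≤ L ^ (20 : ℕ) * B ^ 2 := mul_le_mul_of_nonneg_right hL20 (sq_nonneg B)
      have f3 : (48 + 4 * L ^ (2 : ℕ)) * D ^ 2 ≤ L ^ (20 : ℕ) * D ^ 2 := mul_le_mul_of_nonneg_right hL20 (sq_nonneg D)
      norm_num at f1
      linarith only [f1, f2, f3, sq_nonneg A, sq_nonneg B, sq_nonneg D]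
    have h3 : (L ^ (20 : ℕ) / 4) * (A ^ 2 + B ^ 2 + D ^ 2) ≤ (L ^ (10 : ℕ) * (A + B + D) / 2) ^ 2 := by
      have e : (L ^ (10 : ℕ) * (A + B + D) / 2) ^ 2 = (L ^ (20 : ℕ) / 4) * (A + B + D) ^ 2 := by ring
      rw [e]
      refine mul_le_mul_of_nonneg_left ?_ (by positivity)
      have e : (A + B + D) ^ 2 = A ^ 2 + B ^ 2 + D ^ 2 + 2 * (A * B + A * D + B * D) := by ring
      have hAB := mul_nonneg hA0.le hB0.le
      have hAD := mul_nonneg hA0.le hD0.le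
      have hBD := mul_nonneg hB0.le hD0.le
      linarith only [e, hAB, hAD, hBD]
    linarith only [h1, h2', h3]
  -- take square roots
  have hRHS0 : 0 ≤ (2 : ℝ) ^ (i + j) * (L ^ (10 : ℕ) * (A + B + D)) := by positivity
  have hsq : (boxSum T i j α β) ^ 2 ≤ ((2 : ℝ) ^ (i + j) * (L ^ (10 : ℕ) * (A + B + D))) ^ 2 := by
    refine hin.trans ?_
    calc 4 * (4 : ℝ) ^ i * 4 ^ j * (1 / (2 : ℝ) ^ ρ + 6 / 2 ^ g₀ + 12 * 2 ^ ρ / 2 ^ j + zeroLoss i ρ g₀ η)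
        ≤ 4 * (4 : ℝ) ^ i * 4 ^ j * (L ^ (10 : ℕ) * (A + B + D) / 2) ^ 2 := by
          gcongr
      _ = ((2 : ℝ) ^ (i + j) * (L ^ (10 : ℕ) * (A + B + D))) ^ 2 := by
          rw [show (4 : ℝ) = 2 ^ 2 by norm_num, ← pow_mul, ← pow_mul, pow_add]; ring
  have habs := abs_le_of_sq_le_sq' hsq hRHS0
  calc |boxSum T i j α β| ≤ (2 : ℝ) ^ (i + j) * (L ^ (10 : ℕ) * (A + B + D)) := abs_le.mpr habs
    _ = 2 ^ (i + j) * L ^ (10 : ℕ) * (A + B + D) := by ring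

end Literature.NumberTheory.LFunctions.MoebiusWalsh
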